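import Mathlib.Analysis.Calculus.FDeriv.Measurable
import Mathlib.Analysis.InnerProductSpace.Calculus
import Mathlib.MeasureTheory.Constructions.BorelSpace.ContinuousLinearMap
import Literature.Analysis.FluidPDE.Vorticity
import Literature.Analysis.FluidPDE.SpaceTimeRescaling
import Literature.Analysis.FluidPDE.TaoEnstrophyLocalisation
import HarnessLib

/-!
# Constantin's direction-dissipation density `|ω| |∇ξ|²` and its scaled cylinder functional

Analysis/FluidPDE definition file (notions `directionDissipationDensity`,
`scaledDirectionDissipation`), requested by route
`Summits/NavierStokesRegularity/NavierStokesRegularity/Theses/DirectionDissipationQuantum.lean`,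
whose cruxes inline both expressions verbatim (sibling route `DirectionEnergy` inlines the
`‖·‖ₑ` rendering, `scaledDirectionDissipation_eq_lintegral_enorm`).

For `u : ℝ → ℝ³ → ℝ³` (time first) write `ω(t) = curl u(t)` and `ξ = ω/|ω|` (the tree's
`vorticityDirection`, junk `0` where `ω = 0`). Constantin's **direction-dissipation density** is
`d(t, x) = |ω(t, x)| |∇ₓξ(t, x)|²` (squared Frobenius norm of the Fréchet derivative), the
dissipation term of the balance `(∂ₜ + u·∇ − νΔ)|ω| + ν|ω||∇ξ|² = (ξ·Sξ)|ω|` on `{ω ≠ 0}` and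
the integrand of the a-priori bound for Leray solutions of the Navier–Stokes equations
`∫₀ᵀ∫ |ω| |∇ₓ(ω/|ω|)|² dx dt ≤ ½ν⁻²∫|u₀|² dx` (Constantin 2006, LNM 1871, Sect. 4, display after
Thm. 4.1, p. 47, quoting Constantin 1990). On `{ω ≠ 0}`, `d = (|∇ω|² − |∇|ω||²)/|ω|`; off it
`d = 0`. The **scaled direction dissipation** is the dimensionless cylinder functional
`G(r, z; u) = r⁻¹ ∫∫_{Q_r(z)} d` over the backward parabolic cylinder `Q_r(t, x) = (t − r², t) ×
B_r(x)` (`parabolicCylinder`), the exact analogue of the CKN scaled dissipation `cknE`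
(same `r⁻¹` normalisation, same `ℝ≥0∞` conventions).

## Main statements (all proved)

* `scaledDirectionDissipation_eq` (`rfl` bridge to the route's inline expression),
  `scaledDirectionDissipation_eq_lintegral_enorm`;
* zero field (`directionDissipationDensity_zero`, `scaledDirectionDissipation_zero`); empty
  cylinder for `r ≤ 0` (`scaledDirectionDissipation_of_nonpos`); monotonicity `r G(r) ≤ r' G(r')`
  and `G(r) ≤ (r'/r) G(r')` (`ofReal_mul_scaledDirectionDissipation_mono`,
  `scaledDirectionDissipation_le_mul`);
* unidirectional vorticity (`curl (u t) y = c • e`) has `∇ξ = 0` and `G = 0`, with no continuity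
  assumption: a finitely-valued map has zero Fréchet derivative everywhere
  (`fderiv_vorticityDirection_eq_zero_of_exists_smul`,
  `scaledDirectionDissipation_eq_zero_of_exists_smul`);
* invariance under the Navier–Stokes scaling `u ↦ c u(t₀ + c²s, x₀ + c y)`,
  `G(r, z; u_c) = G(c r, Φ z; u)` with `Φ = stAffine c² c t₀ x₀`, and under translations
  (`directionDissipationDensity_nsZoom`, `scaledDirectionDissipation_nsZoom(_center)`,
  `scaledDirectionDissipation_translate`);
* a.e.-measurability of `d` on `S × ℝ³` for fields jointly smooth on a time set `S` (e.g.
  `Ico 0 T`), although `ξ` is discontinuous at zeros of `ω`: `d = Φ(ω, Dₓω)` for the measurable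
  kernel `Φ(v, M) = ‖v‖ |DN(v) ∘ M|²`, `N(v) = ‖v‖⁻¹v` (Mathlib `measurable_fderiv`)
  (`aemeasurable_directionDissipationDensity`,
  `IsSmoothSpaceTimeOn.aemeasurable_directionDissipationDensity(_cylinder)`).

## Mathlib / tree search

Mathlib (this pin) has no vorticity / direction field / parabolic cylinder. Tree: `curl`,
`frobeniusNormSq` (`VectorCalculus`), `vorticityDirection` (`Vorticity`), `parabolicCylinder`,
`cknE` (`SuitableWeak`), `stAffine`, `stPull`, `fderiv_stPull`, `setLIntegral_preimage_comp_stAffine`,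
`frobeniusNormSq_smul` (`SpaceTimeRescaling`), `curlCLM`, `curl_eq_curlCLM`,
`IsSmoothSpaceTimeOn.fderiv_slice` (`TaoEnstrophyLocalisation`); `lean search
'directionDissipation|scaledDirection'`: nothing. The scaling proof follows `cknE_nsZoom`
(`LocalTypeIScaling`, not imported to keep the cone small; its two bookkeeping lemmas are
re-proved privately).

## Design notes

* Both definitions are *syntactically* the expressions inlined in the route's cruxes, so a
  restatement over the notions is `rfl`.
* Junk values: `d = 0` where `ω = 0` (from `vorticityDirection`) or where a slice is not
  differentiable (`fderiv`); for `r ≤ 0` the cylinder is empty and `G = (ofReal r)⁻¹ * 0 = 0` in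
  `ℝ≥0∞`, exactly as for `cknE`.
* Deliberately NOT here: Constantin's a-priori bound and the `|ω|`-balance themselves (fact /
  theorem material for the filed cite item), Constantin's regularised densities, anything about
  Navier–Stokes solutions.

## References

* P. Constantin, *Euler equations, Navier–Stokes equations and turbulence*, in: Mathematical
  Foundation of Turbulent Viscous Flows, LNM 1871 (2006), Sect. 4, display after Thm. 4.1 (p. 47).
* P. Constantin, *Navier–Stokes equations and area of interfaces*, Comm. Math. Phys. 129 (1990).
* P. Constantin, C. Fefferman, Indiana Univ. Math. J. 42 (1993), §1 (the direction field `ξ`).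
* L. Caffarelli, R. Kohn, L. Nirenberg, CPAM 35 (1982), §2 (scaled quantities, `Q_r`).
-/

noncomputable section

open MeasureTheory Set Function Filter Metric Topology
open scoped ENNReal NNReal

namespace Literature.Analysis.FluidPDE

/-- Local notation for physical space `ℝ³ = EuclideanSpace ℝ (Fin 3)`. -/
local notation "ℝ³" => EuclideanSpace ℝ (Fin 3)

/-! ### The direction-dissipation density -/

/-- **Constantin's direction-dissipation density** `d(t, x) = |ω(t,x)| |∇ₓξ(t,x)|²` of a
time-dependent velocity field `u : ℝ → ℝ³ → ℝ³` (time first): `ω(t) = curl u(t)`,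
`ξ = ω/|ω| = vorticityDirection ω` (junk `0` where `ω = 0`), `|∇ξ|²` the squared Frobenius norm of
the Fréchet derivative of `ξ(t, ·)`. It is the integrand of Constantin's a-priori bound
`∫₀ᵀ∫ |ω| |∇ₓ(ω/|ω|)|² dx dt ≤ ½ν⁻²∫|u₀|²` and the dissipation term of the `|ω|`-balance; it
vanishes where `ω = 0`.
[cite: Constantin2006EulerNSTurbulence, Sect. 4 display after Thm. 4.1 p. 47] -/
def directionDissipationDensity (u : ℝ → ℝ³ → ℝ³) (t : ℝ) (x : ℝ³) : ℝ :=
  ‖curl (u t) x‖ * frobeniusNormSq (fderiv ℝ (vorticityDirection (curl (u t))) x)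

/-- Unfolding the direction-dissipation density. [folklore] -/
theorem directionDissipationDensity_apply (u : ℝ → ℝ³ → ℝ³) (t : ℝ) (x : ℝ³) :
    directionDissipationDensity u t x =
      ‖curl (u t) x‖ * frobeniusNormSq (fderiv ℝ (vorticityDirection (curl (u t))) x) :=
  rfl

/-- The direction-dissipation density is nonnegative. [folklore] -/
theorem directionDissipationDensity_nonneg (u : ℝ → ℝ³ → ℝ³) (t : ℝ) (x : ℝ³) :
    0 ≤ directionDissipationDensity u t x :=
  mul_nonneg (norm_nonneg _) (frobeniusNormSq_nonneg _)

/-- The density vanishes at zeros of the vorticity (the factor `|ω|`). [folklore] -/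
theorem directionDissipationDensity_eq_zero_of_curl_eq_zero {u : ℝ → ℝ³ → ℝ³} {t : ℝ} {x : ℝ³}
    (h : curl (u t) x = 0) : directionDissipationDensity u t x = 0 := by
  rw [directionDissipationDensity, h, norm_zero, zero_mul]

/-- The zero velocity field has zero direction-dissipation density. [folklore] -/
@[simp]
theorem directionDissipationDensity_zero :
    directionDissipationDensity (0 : ℝ → ℝ³ → ℝ³) = 0 := by
  funext t x
  have h : curl ((0 : ℝ → ℝ³ → ℝ³) t) x = 0 := by
    rw [curl_eq_curlCLM]; simp
  rw [Pi.zero_apply, Pi.zero_apply, directionDissipationDensity_eq_zero_of_curl_eq_zero h]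

/-! ### The scaled direction dissipation `G(r, z; u)` -/

/-- **The scaled direction dissipation** `G(r, z; u) = r⁻¹ ∫∫_{Q_r(z)} |ω| |∇ξ|² ∈ [0, ∞]` over the
backward parabolic cylinder `Q_r(t, x) = (t − r², t) × B_r(x)` (`parabolicCylinder r z`): the
Caffarelli–Kohn–Nirenberg-normalised (`r⁻¹`, dimensionless under the Navier–Stokes scaling, cf.
`scaledDirectionDissipation_nsZoom`) cylinder localisation of Constantin's direction-dissipation
integral `∫∫ |ω| |∇ₓ(ω/|ω|)|²` (the density `directionDissipationDensity`, Constantin 2006 Sect. 4),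
posited by route `DirectionDissipationQuantum` in exact analogy with the scaled dissipation `cknE`
(CKN 1982, §2). `ℝ≥0∞`-valued lower integral of `ENNReal.ofReal d`; for `r ≤ 0` the cylinder is
empty and `G = 0` (`scaledDirectionDissipation_of_nonpos`). [folklore] -/
def scaledDirectionDissipation (r : ℝ) (z : ℝ × ℝ³) (u : ℝ → ℝ³ → ℝ³) : ℝ≥0∞ :=
  (ENNReal.ofReal r)⁻¹ *
    ∫⁻ q in parabolicCylinder r z, ENNReal.ofReal (directionDissipationDensity u q.1 q.2)

/-- Unfolding `scaledDirectionDissipation` through the density. [folklore] -/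
theorem scaledDirectionDissipation_def (r : ℝ) (z : ℝ × ℝ³) (u : ℝ → ℝ³ → ℝ³) :
    scaledDirectionDissipation r z u =
      (ENNReal.ofReal r)⁻¹ *
        ∫⁻ q in parabolicCylinder r z, ENNReal.ofReal (directionDissipationDensity u q.1 q.2) :=
  rfl

/-- **Bridge to the route's inline expression** (verbatim the shape used by the cruxes of route
`DirectionDissipationQuantum`, so that restating them over the notion is `rfl`). [folklore] -/
theorem scaledDirectionDissipation_eq (r T : ℝ) (x : ℝ³) (u : ℝ → ℝ³ → ℝ³) :
    scaledDirectionDissipation r (T, x) u =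
      (ENNReal.ofReal r)⁻¹ * (∫⁻ q in parabolicCylinder r ((T, x) : ℝ × ℝ³),
        ENNReal.ofReal (‖curl (u q.1) q.2‖ *
          frobeniusNormSq (fderiv ℝ (vorticityDirection (curl (u q.1))) q.2))) :=
  rfl

/-- The `‖·‖ₑ` rendering of the same quantity (the shape inlined by route `DirectionEnergy`):
`G(r, z; u) = r⁻¹ ∫∫_{Q_r(z)} ‖ω‖ₑ · ofReal |∇ξ|²`. [folklore] -/
theorem scaledDirectionDissipation_eq_lintegral_enorm (r : ℝ) (z : ℝ × ℝ³) (u : ℝ → ℝ³ → ℝ³) :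
    scaledDirectionDissipation r z u =
      (ENNReal.ofReal r)⁻¹ * ∫⁻ q in parabolicCylinder r z,
        ‖curl (u q.1) q.2‖ₑ *
          ENNReal.ofReal (frobeniusNormSq (fderiv ℝ (vorticityDirection (curl (u q.1))) q.2)) := by
  unfold scaledDirectionDissipation directionDissipationDensity
  congr 1
  refine lintegral_congr fun q => ?_
  rw [ENNReal.ofReal_mul (norm_nonneg _), ofReal_norm]

/-- The zero velocity field has `G = 0`. [folklore] -/
@[simp]
theorem scaledDirectionDissipation_zero (r : ℝ) (z : ℝ × ℝ³) :
    scaledDirectionDissipation r z (0 : ℝ → ℝ³ → ℝ³) = 0 := by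
  simp [scaledDirectionDissipation]

/-- For `r ≤ 0` the cylinder `Q_r(z)` is empty, so `G(r, z; u) = 0`
(`(ofReal r)⁻¹ * 0 = 0` in `ℝ≥0∞`). [folklore] -/
theorem scaledDirectionDissipation_of_nonpos {r : ℝ} (hr : r ≤ 0) (z : ℝ × ℝ³)
    (u : ℝ → ℝ³ → ℝ³) : scaledDirectionDissipation r z u = 0 := by
  rw [scaledDirectionDissipation, parabolicCylinder_eq_empty hr, Measure.restrict_empty,
    lintegral_zero_measure, mul_zero]

/-- The unnormalised quantity: `r · G(r, z; u) = ∫∫_{Q_r(z)} d` for `r > 0`. [folklore] -/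
theorem ofReal_mul_scaledDirectionDissipation {r : ℝ} (hr : 0 < r) (z : ℝ × ℝ³)
    (u : ℝ → ℝ³ → ℝ³) :
    ENNReal.ofReal r * scaledDirectionDissipation r z u =
      ∫⁻ q in parabolicCylinder r z, ENNReal.ofReal (directionDissipationDensity u q.1 q.2) := by
  rw [scaledDirectionDissipation, ← mul_assoc,
    ENNReal.mul_inv_cancel (ENNReal.ofReal_pos.2 hr).ne' ENNReal.ofReal_ne_top, one_mul]

/-- Backward parabolic cylinders increase with the radius (`0 ≤ r ≤ r'`). [folklore] -/
private theorem parabolicCylinder_mono_rad {r r' : ℝ} (hr : 0 ≤ r) (h : r ≤ r') (z : ℝ × ℝ³) :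
    parabolicCylinder r z ⊆ parabolicCylinder r' z := by
  have h2 : r ^ 2 ≤ r' ^ 2 := pow_le_pow_left₀ hr h 2
  exact prod_mono (Ioo_subset_Ioo (by linarith) le_rfl) (ball_subset_ball h)

/-- **Monotonicity** of the unnormalised direction dissipation: `r G(r) ≤ r' G(r')` for
`0 < r ≤ r'` (the cylinders are nested and the integrand is nonnegative). [folklore] -/
theorem ofReal_mul_scaledDirectionDissipation_mono {r r' : ℝ} (hr : 0 < r) (hrr' : r ≤ r')
    (z : ℝ × ℝ³) (u : ℝ → ℝ³ → ℝ³) :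
    ENNReal.ofReal r * scaledDirectionDissipation r z u ≤
      ENNReal.ofReal r' * scaledDirectionDissipation r' z u := by
  rw [ofReal_mul_scaledDirectionDissipation hr, ofReal_mul_scaledDirectionDissipation (hr.trans_le hrr')]
  exact lintegral_mono_set (parabolicCylinder_mono_rad hr.le hrr' z)

/-- Consequently `G(r) ≤ (r'/r) G(r')` for `0 < r ≤ r'`. [folklore] -/
theorem scaledDirectionDissipation_le_mul {r r' : ℝ} (hr : 0 < r) (hrr' : r ≤ r') (z : ℝ × ℝ³)
    (u : ℝ → ℝ³ → ℝ³) :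
    scaledDirectionDissipation r z u ≤
      ENNReal.ofReal (r' / r) * scaledDirectionDissipation r' z u := by
  have h := ofReal_mul_scaledDirectionDissipation_mono hr hrr' z u
  rw [ofReal_mul_scaledDirectionDissipation hr] at h
  calc scaledDirectionDissipation r z u
      = (ENNReal.ofReal r)⁻¹ *
          ∫⁻ q in parabolicCylinder r z, ENNReal.ofReal (directionDissipationDensity u q.1 q.2) := rfl
    _ ≤ (ENNReal.ofReal r)⁻¹ * (ENNReal.ofReal r' * scaledDirectionDissipation r' z u) := by
          gcongr
    _ = ENNReal.ofReal (r' / r) * scaledDirectionDissipation r' z u := by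
          rw [← mul_assoc, ENNReal.ofReal_div_of_pos hr, div_eq_mul_inv, mul_comm (ENNReal.ofReal r')]

/-! ### Unidirectional vorticity: `∇ξ = 0` and `G = 0` -/

section FiniteRange

variable {E F : Type*} [NormedAddCommGroup E] [NormedSpace ℝ E] [NormedAddCommGroup F]
  [NormedSpace ℝ F]

/-- A map with values in a finite set has zero Fréchet derivative everywhere: where it is
differentiable it is continuous, hence locally constant; elsewhere `fderiv` is the junk `0`. [folklore] -/
theorem fderiv_eq_zero_of_finite_range {f : E → F} {s : Set F} (hs : s.Finite) (hf : ∀ y, f y ∈ s)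
    (x : E) : fderiv ℝ f x = 0 := by
  by_cases hd : DifferentiableAt ℝ f x
  · have hev : f =ᶠ[𝓝 x] fun _ => f x := by
      have hopen : IsOpen (s \ {f x})ᶜ := ((hs.subset fun _ h => h.1).isClosed).isOpen_compl
      have hmem : (s \ {f x})ᶜ ∈ 𝓝 (f x) := hopen.mem_nhds (by simp)
      filter_upwards [hd.continuousAt.preimage_mem_nhds hmem] with y hy
      by_contra hne
      exact hy ⟨hf y, hne⟩
    rw [hev.fderiv_eq]
    simp
  · exact fderiv_zero_of_not_differentiableAt hd

end FiniteRange

/-- The direction field is invariant under multiplication of the field by a positive scalar: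
`ξ(a ω) = ξ(ω)` for `a > 0`. [folklore] -/
theorem vorticityDirection_const_smul {ω : ℝ³ → ℝ³} {a : ℝ} (ha : 0 < a) (x : ℝ³) :
    vorticityDirection (fun y => a • ω y) x = vorticityDirection ω x := by
  rw [vorticityDirection_apply, vorticityDirection_apply, norm_smul, Real.norm_eq_abs, abs_of_pos ha,
    mul_inv, smul_smul, mul_right_comm, inv_mul_cancel₀ ha.ne', one_mul]

/-- For a field everywhere parallel to one vector `e` (`ω y = c(y) e`), the direction field takes
only the values `‖e‖⁻¹ e`, `−‖e‖⁻¹ e`, `0`. [folklore] -/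
theorem vorticityDirection_mem_of_exists_smul {ω : ℝ³ → ℝ³} {e : ℝ³}
    (h : ∀ y, ∃ c : ℝ, ω y = c • e) (y : ℝ³) :
    vorticityDirection ω y ∈ ({‖e‖⁻¹ • e, -(‖e‖⁻¹ • e), 0} : Set ℝ³) := by
  obtain ⟨c, hc⟩ := h y
  simp only [mem_insert_iff, mem_singleton_iff]
  rw [vorticityDirection_apply, hc, norm_smul, Real.norm_eq_abs, mul_inv, smul_smul]
  rcases lt_trichotomy c 0 with hc0 | rfl | hc0
  · refine Or.inr (Or.inl ?_)
    rw [abs_of_neg hc0, inv_neg, neg_mul, neg_mul, mul_right_comm, inv_mul_cancel₀ hc0.ne,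
      one_mul, neg_smul]
  · exact Or.inr (Or.inr (by simp))
  · refine Or.inl ?_
    rw [abs_of_pos hc0, mul_right_comm, inv_mul_cancel₀ hc0.ne', one_mul]

/-- **Unidirectional vorticity has `∇ξ = 0`.** If `ω` is everywhere parallel to a fixed vector
`e` (`ω y = c(y) e`, any signs, no continuity assumed), then `fderiv ℝ (vorticityDirection ω) x = 0`
at every `x` (the direction field is finitely valued). [folklore] -/
theorem fderiv_vorticityDirection_eq_zero_of_exists_smul {ω : ℝ³ → ℝ³} {e : ℝ³}
    (h : ∀ y, ∃ c : ℝ, ω y = c • e) (x : ℝ³) : fderiv ℝ (vorticityDirection ω) x = 0 :=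
  fderiv_eq_zero_of_finite_range (Set.toFinite _) (vorticityDirection_mem_of_exists_smul h) x

/-- Unidirectional vorticity at time `t` forces `d(t, ·) ≡ 0`. [folklore] -/
theorem directionDissipationDensity_eq_zero_of_exists_smul {u : ℝ → ℝ³ → ℝ³} {t : ℝ} {e : ℝ³}
    (h : ∀ y, ∃ c : ℝ, curl (u t) y = c • e) (x : ℝ³) : directionDissipationDensity u t x = 0 := by
  rw [directionDissipationDensity, fderiv_vorticityDirection_eq_zero_of_exists_smul h x,
    frobeniusNormSq_zero, mul_zero]

/-- **Unidirectional vorticity has `G = 0`**: if on every time slice of the window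
`(t − r², t)` the vorticity is everywhere parallel to one vector (which may depend on the slice),
then `G(r, z; u) = 0` (e.g. `2.5`-dimensional fields, the zero field). [folklore] -/
theorem scaledDirectionDissipation_eq_zero_of_exists_smul {u : ℝ → ℝ³ → ℝ³} {r : ℝ} {z : ℝ × ℝ³}
    (h : ∀ t ∈ Ioo (z.1 - r ^ 2) z.1, ∃ e : ℝ³, ∀ y, ∃ c : ℝ, curl (u t) y = c • e) :
    scaledDirectionDissipation r z u = 0 := by
  have hQ : MeasurableSet (parabolicCylinder r z) := (isOpen_parabolicCylinder r z).measurableSet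
  have hae : ∀ᵐ q ∂(volume.restrict (parabolicCylinder r z)),
      ENNReal.ofReal (directionDissipationDensity u q.1 q.2) = (fun _ => 0) q := by
    refine (ae_restrict_iff' hQ).2 (ae_of_all _ fun q hq => ?_)
    obtain ⟨e, he⟩ := h q.1 ((mem_parabolicCylinder.1 hq).1)
    rw [directionDissipationDensity_eq_zero_of_exists_smul he, ENNReal.ofReal_zero]
  rw [scaledDirectionDissipation, lintegral_congr_ae hae, lintegral_zero, mul_zero]

/-! ### Navier–Stokes scaling and translations -/

/-- The curl of the amplitude-`c` pull-back along `Φ(s, y) = (t₀ + β s, x₀ + γ y)`: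
`curl ((c u) ∘ Φ)(s, ·)(y) = (c γ) curl u(t)(x)`, `(t, x) = Φ(s, y)` (chain rule, no
differentiability needed). [folklore] -/
theorem curl_smul_stPull (c β γ t₀ : ℝ) (x₀ : ℝ³) (u : ℝ → ℝ³ → ℝ³) (s : ℝ) (y : ℝ³) :
    curl ((c • stPull β γ t₀ x₀ u) s) y = (c * γ) • curl (u (t₀ + β * s)) (x₀ + γ • y) := by
  have h1 : (c • stPull β γ t₀ x₀ u) s = c • stPull β γ t₀ x₀ u s := rfl
  rw [curl_eq_curlCLM, curl_eq_curlCLM, h1, fderiv_const_smul_field, Pi.smul_apply, fderiv_stPull,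
    smul_smul, map_smul]

/-- **The density under the Navier–Stokes scaling** `u_c(s, y) = c u(t₀ + c² s, x₀ + c y)`, `c ≠ 0`:
`d[u_c](s, y) = c⁴ d[u](t₀ + c² s, x₀ + c y)` (`ω_c = c² ω ∘ Φ`, `ξ_c = ξ ∘ Φ`,
`∇ξ_c = c (∇ξ) ∘ Φ`). [folklore] -/
theorem directionDissipationDensity_nsZoom {c : ℝ} (hc : c ≠ 0) (t₀ : ℝ) (x₀ : ℝ³)
    (u : ℝ → ℝ³ → ℝ³) (s : ℝ) (y : ℝ³) :
    directionDissipationDensity (c • stPull (c ^ 2) c t₀ x₀ u) s y =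
      c ^ 4 * directionDissipationDensity u (t₀ + c ^ 2 * s) (x₀ + c • y) := by
  have hc2 : 0 < c ^ 2 := by positivity
  have hcurl : curl ((c • stPull (c ^ 2) c t₀ x₀ u) s) =
      fun y => c ^ 2 • curl (u (t₀ + c ^ 2 * s)) (x₀ + c • y) := by
    funext y; rw [curl_smul_stPull, ← pow_two]
  have hdir : vorticityDirection (curl ((c • stPull (c ^ 2) c t₀ x₀ u) s)) =
      stPull (c ^ 2) c t₀ x₀ (fun t x => vorticityDirection (curl (u t)) x) s := by
    funext y
    rw [hcurl, stPull_apply]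
    exact vorticityDirection_const_smul hc2 _
  rw [directionDissipationDensity, directionDissipationDensity, hdir, fderiv_stPull,
    frobeniusNormSq_smul, hcurl]
  simp only [norm_smul, Real.norm_eq_abs, abs_of_pos hc2]
  ring

/-- Bookkeeping for the zoom: `Φ⁻¹(Q_{c r}(Φ z)) = Q_r(z)` for `Φ = stAffine c² c t₀ x₀`,
`c > 0`. [folklore] -/
private theorem stAffine_preimage_parabolicCylinder_zoom {c : ℝ} (hc : 0 < c) (t₀ : ℝ) (x₀ : ℝ³)
    (r : ℝ) (z : ℝ × ℝ³) :
    stAffine (c ^ 2) c t₀ x₀ ⁻¹' parabolicCylinder (c * r) (stAffine (c ^ 2) c t₀ x₀ z) =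
      parabolicCylinder r z := by
  have hc2 : 0 < c ^ 2 := by positivity
  rw [parabolicCylinder, stAffine_fst, stAffine_snd, stAffine_preimage_cylinder hc2 hc,
    parabolicCylinder]
  congr 1
  · congr 1
    · field_simp
      ring
    · field_simp
      ring
  · congr 1
    · rw [add_sub_cancel_left, smul_smul, inv_mul_cancel₀ hc.ne', one_smul]
    · field_simp

/-- Bookkeeping for the zoom: `r⁻¹ · c⁴ · (c² c³)⁻¹ = (c r)⁻¹` in `ℝ≥0∞`. [folklore] -/
private theorem scaleConst_zoom {c r : ℝ} (hc : 0 < c) (hr : 0 < r) :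
    (ENNReal.ofReal r)⁻¹ * ENNReal.ofReal c ^ 4 * ENNReal.ofReal (c ^ 2 * c ^ 3)⁻¹ =
      (ENNReal.ofReal (c * r))⁻¹ := by
  rw [← ENNReal.ofReal_pow hc.le, ← ENNReal.ofReal_inv_of_pos hr,
    ← ENNReal.ofReal_inv_of_pos (by positivity : (0:ℝ) < c * r),
    ← ENNReal.ofReal_mul (by positivity), ← ENNReal.ofReal_mul (by positivity)]
  congr 1
  field_simp

/-- **Scale invariance of `G`** under the Navier–Stokes scaling
`u_c(s, y) = c u(t₀ + c² s, x₀ + c y)` (`c > 0`; `c • stPull (c ^ 2) c t₀ x₀ u`):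
`G(r, z; u_c) = G(c r, Φ z; u)`, `Φ(s, y) = (t₀ + c² s, x₀ + c y)` — the same scaling as the CKN
quantity `E` (`cknE_nsZoom`): the integrand has weight `c⁴`, the Jacobian is `c⁻⁵`, the
normalisation `r⁻¹`. [folklore] -/
theorem scaledDirectionDissipation_nsZoom {c : ℝ} (hc : 0 < c) (r t₀ : ℝ) (x₀ : ℝ³) (z : ℝ × ℝ³)
    (u : ℝ → ℝ³ → ℝ³) :
    scaledDirectionDissipation r z (c • stPull (c ^ 2) c t₀ x₀ u) =
      scaledDirectionDissipation (c * r) (stAffine (c ^ 2) c t₀ x₀ z) u := by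
  rcases le_or_gt r 0 with hr | hr
  · rw [scaledDirectionDissipation_of_nonpos hr,
      scaledDirectionDissipation_of_nonpos (mul_nonpos_of_nonneg_of_nonpos hc.le hr)]
  have hc2 : 0 < c ^ 2 := by positivity
  unfold scaledDirectionDissipation
  rw [← stAffine_preimage_parabolicCylinder_zoom hc t₀ x₀ r z]
  have hpt : ∀ q : ℝ × ℝ³,
      ENNReal.ofReal (directionDissipationDensity (c • stPull (c ^ 2) c t₀ x₀ u) q.1 q.2) =
        ENNReal.ofReal c ^ 4 *
          ENNReal.ofReal (directionDissipationDensity u (t₀ + c ^ 2 * q.1) (x₀ + c • q.2)) := by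
    intro q
    rw [directionDissipationDensity_nsZoom hc.ne', ENNReal.ofReal_mul (by positivity),
      ENNReal.ofReal_pow hc.le]
  simp_rw [hpt]
  rw [lintegral_const_mul' _ _ (by simp)]
  have key := setLIntegral_preimage_comp_stAffine (E := ℝ³) hc2 hc t₀ x₀
    (fun w : ℝ × ℝ³ => ENNReal.ofReal (directionDissipationDensity u w.1 w.2))
    (parabolicCylinder (c * r) (stAffine (c ^ 2) c t₀ x₀ z))
  simp only [stAffine_fst, stAffine_snd, finrank_euclideanSpace_fin] at key
  rw [key, ← mul_assoc, ← mul_assoc, scaleConst_zoom hc hr]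

/-- Scale invariance about the centre (the form used for blow-up at a top point `(T, x)`):
`G(ρ, (0, 0); c u(T + c² ·, x + c ·)) = G(c ρ, (T, x); u)` for `c > 0`. [folklore] -/
theorem scaledDirectionDissipation_nsZoom_center {c : ℝ} (hc : 0 < c) (ρ T : ℝ) (x : ℝ³)
    (u : ℝ → ℝ³ → ℝ³) :
    scaledDirectionDissipation ρ ((0 : ℝ), (0 : ℝ³)) (c • stPull (c ^ 2) c T x u) =
      scaledDirectionDissipation (c * ρ) (T, x) u := by
  rw [scaledDirectionDissipation_nsZoom hc]
  congr 1
  simp [stAffine]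

/-- **Translation invariance**: `G(r, z; u(t₀ + ·, x₀ + ·)) = G(r, (t₀, x₀) + z; u)`. [folklore] -/
theorem scaledDirectionDissipation_translate (r t₀ : ℝ) (x₀ : ℝ³) (z : ℝ × ℝ³)
    (u : ℝ → ℝ³ → ℝ³) :
    scaledDirectionDissipation r z (fun t x => u (t₀ + t) (x₀ + x)) =
      scaledDirectionDissipation r (t₀ + z.1, x₀ + z.2) u := by
  have h1 : (fun t x => u (t₀ + t) (x₀ + x)) = (1 : ℝ) • stPull ((1 : ℝ) ^ 2) 1 t₀ x₀ u := by
    funext t x; simp [stPull_apply]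
  have h2 : ((t₀ + z.1, x₀ + z.2) : ℝ × ℝ³) = stAffine ((1 : ℝ) ^ 2) 1 t₀ x₀ z := by
    simp [stAffine]
  rw [h1, h2, scaledDirectionDissipation_nsZoom one_pos, one_mul]

/-! ### Measurability of the density for jointly smooth fields -/

/-- The normalisation map `N(v) = ‖v‖⁻¹ v` is differentiable away from the origin. [folklore] -/
private theorem differentiableAt_normalize {v : ℝ³} (hv : v ≠ 0) :
    DifferentiableAt ℝ (fun w : ℝ³ => ‖w‖⁻¹ • w) v :=
  ((differentiableAt_id.norm ℝ hv).inv (norm_ne_zero_iff.mpr hv)).smul differentiableAt_id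

/-- `ξ = N ∘ ω` with `N(v) = ‖v‖⁻¹ v`. [folklore] -/
private theorem vorticityDirection_eq_comp (ω : ℝ³ → ℝ³) :
    vorticityDirection ω = (fun w : ℝ³ => ‖w‖⁻¹ • w) ∘ ω :=
  rfl

/-- **Chain-rule form of the density.** Where the vorticity slice `ω(t, ·)` is differentiable,
`d(t, x) = ‖ω‖ · |DN(ω) ∘ Dω|²` with `N(v) = ‖v‖⁻¹ v` (at zeros of `ω` both sides vanish; elsewhere
`N` is differentiable and the chain rule applies). [folklore] -/
theorem directionDissipationDensity_eq_of_differentiableAt {u : ℝ → ℝ³ → ℝ³} {t : ℝ} {x : ℝ³}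
    (hω : DifferentiableAt ℝ (curl (u t)) x) :
    directionDissipationDensity u t x =
      ‖curl (u t) x‖ *
        frobeniusNormSq ((fderiv ℝ (fun w : ℝ³ => ‖w‖⁻¹ • w) (curl (u t) x)).comp
          (fderiv ℝ (curl (u t)) x)) := by
  by_cases h0 : curl (u t) x = 0
  · simp [directionDissipationDensity, h0]
  · rw [directionDissipationDensity, vorticityDirection_eq_comp,
      fderiv_comp x (differentiableAt_normalize h0) hω]

/-- The squared Frobenius norm is continuous on `ℝ³ →L[ℝ] ℝ³`. [folklore] -/
private theorem continuous_frobeniusNormSq₃ :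
    Continuous fun L : ℝ³ →L[ℝ] ℝ³ => frobeniusNormSq L := by
  unfold frobeniusNormSq
  refine continuous_finsetSum _ fun i _ => ?_
  exact (continuous_eval_const (stdOrthonormalBasis ℝ ℝ³ i)).norm.pow 2

/-- Measurability of the two-variable kernel `Φ(v, M) = ‖v‖ |DN(v) ∘ M|²` (Mathlib
`measurable_fderiv` for `DN`, continuity of composition and of the Frobenius norm). [folklore] -/
private theorem measurable_densityKernel :
    Measurable fun p : ℝ³ × (ℝ³ →L[ℝ] ℝ³) =>
      ‖p.1‖ * frobeniusNormSq ((fderiv ℝ (fun w : ℝ³ => ‖w‖⁻¹ • w) p.1).comp p.2) := by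
  have hA : Measurable fun p : ℝ³ × (ℝ³ →L[ℝ] ℝ³) => fderiv ℝ (fun w : ℝ³ => ‖w‖⁻¹ • w) p.1 :=
    (measurable_fderiv ℝ _).comp measurable_fst
  have hc : Continuous fun q : (ℝ³ →L[ℝ] ℝ³) × (ℝ³ →L[ℝ] ℝ³) => q.1.comp q.2 :=
    continuous_fst.clm_comp continuous_snd
  have hB : Measurable fun p : ℝ³ × (ℝ³ →L[ℝ] ℝ³) =>
      (fderiv ℝ (fun w : ℝ³ => ‖w‖⁻¹ • w) p.1).comp p.2 :=
    hc.measurable.comp (hA.prodMk measurable_snd)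
  exact (continuous_norm.measurable.comp measurable_fst).mul
    (continuous_frobeniusNormSq₃.measurable.comp hB)

/-- **Measurability of the density.** If on the time set `S` the vorticity slices `ω(t, ·)` are
differentiable and `ω`, `Dₓω` are jointly continuous on `S × ℝ³`, then `(t, x) ↦ d(t, x)` is
a.e.-measurable on `S × ℝ³` (it is the measurable kernel `Φ(ω, Dω)` there), although the direction
field `ξ` is discontinuous at the zeros of `ω`. [folklore] -/
theorem aemeasurable_directionDissipationDensity {u : ℝ → ℝ³ → ℝ³} {S : Set ℝ}
    (hS : MeasurableSet S) (hdiff : ∀ t ∈ S, Differentiable ℝ (curl (u t)))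
    (hω : ContinuousOn (fun q : ℝ × ℝ³ => curl (u q.1) q.2) (S ×ˢ univ))
    (hDω : ContinuousOn (fun q : ℝ × ℝ³ => fderiv ℝ (curl (u q.1)) q.2) (S ×ˢ univ)) :
    AEMeasurable (fun q : ℝ × ℝ³ => directionDissipationDensity u q.1 q.2)
      (volume.restrict (S ×ˢ univ)) := by
  have hSm : MeasurableSet (S ×ˢ (univ : Set ℝ³)) := hS.prod MeasurableSet.univ
  have hpair : AEMeasurable (fun q : ℝ × ℝ³ => (curl (u q.1) q.2, fderiv ℝ (curl (u q.1)) q.2))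
      (volume.restrict (S ×ˢ univ)) :=
    (hω.aemeasurable hSm).prodMk (hDω.aemeasurable hSm)
  refine (measurable_densityKernel.comp_aemeasurable hpair).congr ?_
  filter_upwards [ae_restrict_mem hSm] with q hq
  exact (directionDissipationDensity_eq_of_differentiableAt (hdiff q.1 hq.1 q.2)).symm

/-- The vorticity of a field jointly smooth on `S × ℝ³` (`S` of unique differentiability) is
jointly smooth there. [folklore] -/
private theorem isSmoothSpaceTimeOn_curl_slice {u : ℝ → ℝ³ → ℝ³} {S : Set ℝ}
    (h : IsSmoothSpaceTimeOn S u) (hS : UniqueDiffOn ℝ S) :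
    IsSmoothSpaceTimeOn S (fun t x => curl (u t) x) := by
  have h1 := h.fderiv_slice hS
  have h2 : ContDiffOn ℝ (⊤ : ℕ∞) (curlCLM ∘ uncurry fun t x => fderiv ℝ (u t) x) (S ×ˢ univ) :=
    curlCLM.contDiff.comp_contDiffOn h1
  exact h2

/-- **Measurability of the density for jointly smooth fields.** For `u` jointly `C^∞` on
`S × ℝ³` with `S` a time set of unique differentiability (e.g. `Ico 0 T`, `T > 0`: a classical
solution below its top time), the density `d` is a.e.-measurable on `S × ℝ³`. [folklore] -/
theorem IsSmoothSpaceTimeOn.aemeasurable_directionDissipationDensity {u : ℝ → ℝ³ → ℝ³}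
    {S : Set ℝ} (h : IsSmoothSpaceTimeOn S u) (hS : UniqueDiffOn ℝ S) (hSm : MeasurableSet S) :
    AEMeasurable (fun q : ℝ × ℝ³ => directionDissipationDensity u q.1 q.2)
      (volume.restrict (S ×ˢ univ)) := by
  have hω : IsSmoothSpaceTimeOn S (fun t x => curl (u t) x) := isSmoothSpaceTimeOn_curl_slice h hS
  refine _root_.Literature.Analysis.FluidPDE.aemeasurable_directionDissipationDensity hSm
    (fun t ht => ?_) hω.continuousOn (hω.fderiv_slice hS).continuousOn
  exact (hω.contDiff_slice ht).differentiable (by simp)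

/-- The cylinder form for the route: for `u` jointly smooth on `[0, T) × ℝ³` and a cylinder
`Q_r(T, x)` inside the slab (`r² ≤ T`), the density is a.e.-measurable on `Q_r(T, x)`, and so is
`ofReal d`, the integrand of `G`. [folklore] -/
theorem IsSmoothSpaceTimeOn.aemeasurable_directionDissipationDensity_cylinder {u : ℝ → ℝ³ → ℝ³}
    {T r : ℝ} (h : IsSmoothSpaceTimeOn (Ico 0 T) u) (hr : r ^ 2 ≤ T) (x : ℝ³) :
    AEMeasurable (fun q : ℝ × ℝ³ => ENNReal.ofReal (directionDissipationDensity u q.1 q.2))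
      (volume.restrict (parabolicCylinder r (T, x))) := by
  have hsub : parabolicCylinder r ((T, x) : ℝ × ℝ³) ⊆ Ico 0 T ×ˢ univ :=
    prod_mono (fun t ht => ⟨by linarith [ht.1], ht.2⟩) (subset_univ _)
  have h1 := h.aemeasurable_directionDissipationDensity (uniqueDiffOn_Ico 0 T) measurableSet_Ico
  exact ENNReal.measurable_ofReal.comp_aemeasurable (h1.mono_measure (Measure.restrict_mono hsub le_rfl))

end Literature.Analysis.FluidPDE
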